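import Mathlib.Combinatorics.SimpleGraph.Metric
import Mathlib.Analysis.SpecialFunctions.Exp
import Literature.Probability.LatticeModels.IndependencePolynomial
import HarnessLib

/-!
# The hard-core model on a finite graph with a boundary condition, and Weitz's strong spatial mixing theorem

Topic `Literature/Probability/LatticeModels` (finite-volume Gibbs measures of the hard-core
lattice gas = weighted independent sets; the correlation-decay input of Weitz's counting
algorithm and of the Borgs–Chayes–Kahn–Lovász free-energy convergence for bounded-degree graph
sequences).

For a finite simple graph `G` on `V`, an activity `λ` and a *boundary condition* `(Λ, R)` — a set
of vertices `Λ` whose state is prescribed, `R ⊆ Λ` being the occupied ones — we define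

* `hardCoreZ G λ Λ R = ∑_{I independent, I ∩ Λ = R} λ^{|I|}`, the partition function restricted
  to the independent sets compatible with the boundary condition; with the empty boundary
  condition it is the tree's hard-core partition function
  `Literature.Probability.LatticeModels.independencePolynomial G λ = ∑_{I independent} λ^{|I|}`
  (`IndependencePolynomial.lean`), `hardCoreZ_empty`;
* `hardCoreOccProb G λ Λ R v = P_{G,λ}(v ∈ I ∣ I ∩ Λ = R)`, the conditional *occupation
  probability* of Weitz (2006), §2 (`p_v^{σ_Λ}`), as a ratio of restricted partition functions;
* `HardCoreExpSSM G λ C α`: *strong spatial mixing with exponential rate* `δ(ℓ) = C e^{-αℓ}`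
  (Weitz 2006, Def. 2.2 and the Remark following it): for every vertex `v`, every `Λ` and any
  two boundary conditions `(Λ, R)`, `(Λ, R')` specifying independent sets and differing only on
  a set of vertices at graph distance `≥ ℓ` from `v`,
  `|P(v ∈ I ∣ R) - P(v ∈ I ∣ R')| ≤ C e^{-αℓ}`;

and we vendor as a NAMED FACT (D-0014), with the tree's tree-uniqueness threshold
`Literature.Probability.LatticeModels.hardCoreThreshold Δ = (Δ-1)^{Δ-1}/(Δ-2)^Δ`
(`IndependencePolynomial.lean`; Weitz's `λ_c(b) = b^b/(b-1)^{b+1}`, `b = Δ - 1`, Prop. 2.5),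

* `Weitz2006_hardCoreSSM`: for `Δ ≥ 3` and `0 < λ < λ_c(Δ)` there are `C, α > 0` such that the
  hard-core model with activity `λ` on EVERY finite graph of maximum degree `≤ Δ` exhibits strong
  spatial mixing with rate `C e^{-αℓ}` — Weitz (2006), Corollary 2.6 (strict case), which the
  paper obtains from Theorem 2.3 (the regular tree `T̂_b`, `b = Δ - 1`, is the worst case for
  strong spatial mixing among graphs of maximum degree `b + 1`, via the self-avoiding-walk tree
  of Theorem 3.1), Theorem 2.4 (weak ⇒ strong spatial mixing on `T̂_b`) and Proposition 2.5
  (weak spatial mixing on `T̂_b` with exponential rate for `λ < λ_c(b)`);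

together with the geometric-rate form `Weitz2006_hardCoreSSM.geometric` (`C γ^ℓ`, `γ < 1`) and
elementary API (`hardCoreZ_empty`, `hardCoreZ_pos`, `hardCoreOccProb_nonneg`,
`hardCoreOccProb_le_one`, `hardCoreOccProb_eq_one_of_mem`,
`hardCoreOccProb_eq_zero_of_mem_of_not_mem`, `hardCoreThreshold_four`).

## Design and faithfulness notes

* Graphs are finite (`Fintype V`); Weitz states Cor. 2.6 for "every graph of maximum degree
  `b + 1`", the partition function being a finite sum (§2); infinite graphs enter only through the
  parenthetical uniqueness-of-Gibbs-measure remark, which is not vendored. "Maximum degree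
  `b + 1`" is read as `G.maxDegree ≤ Δ` (a graph of smaller maximum degree is a graph of maximum
  degree `≤ b + 1`; the proof — `T_saw(G, v)` is a subtree of `T̂_b` — uses only the upper bound).
* Weitz's `b ≥ 1` includes `Δ = 2` with `λ_c(1) = ∞`; we state the fact for `Δ ≥ 3` only (the
  case the formula `(Δ-1)^{Δ-1}/(Δ-2)^Δ` is finite), which is weaker than the source.
* Boundary conditions "specify independent sets of `Λ`" (Weitz §2), so the conditional
  probabilities are well defined: we require `R ⊆ Λ`, `R' ⊆ Λ` and `G.IsIndepSet R`,
  `G.IsIndepSet R'`; then `hardCoreZ G λ Λ R > 0` for `λ > 0` (`hardCoreZ_pos`) and no junk value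
  of `/` is involved. The vertex `v` may lie in `Λ` (as in the source: "for every `v ∈ V`,
  `Λ ⊂ V`"); then `p_v ∈ {0, 1}` is prescribed (`hardCoreOccProb_eq_one_of_mem`,
  `hardCoreOccProb_eq_zero_of_mem_of_not_mem`).
* Distances are Mathlib's `SimpleGraph.edist : V → V → ℕ∞` (`⊤` between different components).
  "`σ_Λ`, `τ_Λ` differ only on a set `Δ` with `dist(v, Δ) ≥ ℓ`" is rendered as
  `∀ w, (w ∈ R ↔ w ∉ R') → ℓ ≤ G.edist v w`; for the monotone rate `C e^{-αℓ}` this is the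
  definition `|p^σ - p^τ| ≤ δ(dist(v, Δ))` of Def. 2.2 (when `Δ = ∅` the two boundary conditions
  coincide; when `Δ` lies in other components of `G` the bound holds for every `ℓ`, i.e. the two
  probabilities agree, as they do since the conditional measure factorises over components).
* The activity is a real `λ > 0` as in Weitz §2; weights `λ^{|I|}` count the boundary vertices
  too (a common factor `λ^{|R|}` of numerator and denominator).
* Library fit. USED from the tree: `independencePolynomial` (the unconditioned partition
  function `Z_G`), `hardCoreThreshold` (`λ_c(Δ)`, with `hardCoreThreshold_three`,
  `hardCoreThreshold_pos`) of `IndependencePolynomial.lean`, which also carries the companion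
  named fact `PetersRegts2019_zeroFree` (zero-freeness on a complex neighbourhood of
  `[0, λ_c(Δ))`, the depth-scale partner of the present density-scale input in route
  PneNP/PhaseTwins). Mathlib has `SimpleGraph.IsIndepSet`, `SimpleGraph.maxDegree`,
  `SimpleGraph.edist`, but no conditional Gibbs probabilities of the hard-core model and no
  spatial-mixing notion (`lean search 'SpatialMixing|occProb|boundary condition'`); the tree's
  `HardCoreUrsell` / `PolymerGas` treat the abstract polymer expansion, not conditional
  occupation probabilities. New here: only the boundary-condition layer (`hardCoreZ`,
  `hardCoreOccProb`, `HardCoreExpSSM`) and Weitz's theorem.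
* NOT here: weak spatial mixing, the self-avoiding-walk tree `T_saw` and Theorem 3.1 itself,
  Theorem 2.7 / Cor. 2.8 (the FPTAS), Glauber dynamics (Thm 2.9), the matching lower bound of
  Sly (2010) above `λ_c`.

## References

* D. Weitz, *Counting independent sets up to the tree threshold*, Proc. 38th STOC (2006),
  140–149, doi:10.1145/1132516.1132538 [Weitz2006]. Theorem/definition numbers below are those of
  the author's full version (dated 16 March 2006, www.drorweitz.com/ac/pubs/ind_from_tree.pdf):
  §2 Def. 2.1–2.2, Thm. 2.3–2.4, Prop. 2.5, Cor. 2.6; §3 Thm. 3.1.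
* R. Restrepo, J. Shin, P. Tetali, E. Vigoda, L. Yang, *Improved mixing condition on the grid for
  counting and sampling independent sets*, Probab. Theory Related Fields 156 (2013) 75–99,
  arXiv:1105.0914 — §2.1 Def. 1–2 (WSM/SSM with rate `γ^{dist}`), §2.2 Thm. 1 (= Weitz's
  Thm. 3.1) and Cor. 2, §4 (a second proof of SSM on all graphs of maximum degree `Δ` for
  `λ < λ_c(𝕋_Δ)`). Secondary source restating the result. [RestrepoEtAl2012]
* A. Sinclair, P. Srivastava, D. Štefankovič, Y. Yin, *Spatial mixing and the connective
  constant: optimal bounds*, Probab. Theory Related Fields 168 (2017), doi:10.1007/s00440-016-0708-2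
  — §2.1.2–2.1.3 (boundary conditions `σ = (S, I_S)`, occupation probability, Def. 2.3 of SSM),
  Thm. 2.2 (Weitz's SAW-tree reduction). Secondary source. [SinclairEtAl2016]
-/

noncomputable section

open Finset

namespace Literature.Probability.LatticeModels

variable {V : Type*} [Fintype V] [DecidableEq V] (G : SimpleGraph V) [DecidableRel G.Adj]

/-! ### Restricted partition functions and occupation probabilities -/

/-- The hard-core partition function of the finite graph `G` at activity `lam` with boundary
condition `(Λ, R)`: `Z_G^{Λ,R}(λ) = ∑ λ^{|I|}` over the independent sets `I` of `G` with
`I ∩ Λ = R` (the vertices of `Λ` are prescribed: those in `R` occupied, those in `Λ \ R`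
unoccupied). With `Λ = R = ∅` this is `Z_G(λ) = ∑_{I independent} λ^{|I|}` (`hardCoreZ_empty`).
[cite: Weitz2006, §2] -/
def hardCoreZ (lam : ℝ) (Λ R : Finset V) : ℝ :=
  ∑ I : Finset V, if G.IsIndepSet (I : Set V) ∧ I ∩ Λ = R then lam ^ I.card else 0

/-- The conditional occupation probability `p_v^{σ_Λ} = P_{G,λ}(v ∈ I ∣ I ∩ Λ = R)` of the
hard-core model on `G` at activity `lam` under the boundary condition `(Λ, R)`: the weight of the
compatible independent sets containing `v` divided by `hardCoreZ G lam Λ R`. (Junk value `0` when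
the boundary condition is infeasible, i.e. when `hardCoreZ G lam Λ R = 0`; for `lam > 0`, `R ⊆ Λ`
independent this does not happen, `hardCoreZ_pos`.)
[cite: Weitz2006, §2] -/
def hardCoreOccProb (lam : ℝ) (Λ R : Finset V) (v : V) : ℝ :=
  (∑ I : Finset V, if G.IsIndepSet (I : Set V) ∧ I ∩ Λ = R ∧ v ∈ I then lam ^ I.card else 0) /
    hardCoreZ G lam Λ R

/-- **Strong spatial mixing with exponential rate** `δ(ℓ) = C e^{-αℓ}` for the hard-core model on
the finite graph `G` at activity `lam` (Weitz's Definition 2.2 together with the Remark following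
it): for every vertex `v`, every set `Λ` of prescribed vertices and any two boundary conditions
`(Λ, R)`, `(Λ, R')` specifying independent sets of `Λ`, if every vertex on which they differ
(`w ∈ R ↔ w ∉ R'`) is at graph distance `≥ ℓ` from `v` (Mathlib's `SimpleGraph.edist`, `= ⊤`
across components), then `|p_v^{(Λ,R)} - p_v^{(Λ,R')}| ≤ C e^{-αℓ}`.
[cite: Weitz2006, Def. 2.2 and Remark] -/
def HardCoreExpSSM (lam C α : ℝ) : Prop :=
  ∀ (v : V) (Λ R R' : Finset V), R ⊆ Λ → R' ⊆ Λ →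
    G.IsIndepSet (R : Set V) → G.IsIndepSet (R' : Set V) →
    ∀ ℓ : ℕ, (∀ w : V, (w ∈ R ↔ w ∉ R') → (ℓ : ℕ∞) ≤ G.edist v w) →
      |hardCoreOccProb G lam Λ R v - hardCoreOccProb G lam Λ R' v| ≤ C * Real.exp (-(α * ℓ))

/-! ### Weitz's theorem (named fact) -/

/-- **Weitz (2006): strong spatial mixing for the hard-core model on all graphs of maximum degree
`Δ` below the tree uniqueness threshold.** For every `Δ ≥ 3` and every activity
`0 < λ < λ_c(Δ) = hardCoreThreshold Δ = (Δ-1)^{Δ-1}/(Δ-2)^Δ` there exist constants `C, α > 0`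
(depending on `Δ` and `λ` only) such that for EVERY finite graph `G` of maximum degree `≤ Δ`,
the hard-core model on `G` with activity `λ` exhibits strong spatial mixing with rate
`δ(ℓ) = C e^{-αℓ}` (`HardCoreExpSSM`). This is Corollary 2.6 of Weitz (strict case `λ < λ_c(b)`, `b = Δ - 1`:
"the rate `δ` can be taken to decay exponentially fast (with constants that depend on `b` and
`λ`)"), obtained there from Theorem 2.3 (if the regular tree `T̂_b` exhibits strong spatial mixing
with rate `δ` then so does every graph of maximum degree `b + 1`, proved through the
self-avoiding-walk tree `T_saw(G, v)` of Theorem 3.1), Theorem 2.4 (on `T̂_b` weak spatial mixing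
with rate `δ` implies strong spatial mixing with rate `(1+λ)(λ+(1+λ)^{b+1})/λ · δ`) and
Proposition 2.5 (`T̂_b` has weak spatial mixing with a rate tending to zero iff
`λ ≤ λ_c(b) = b^b/(b-1)^{b+1}`, and with an exponentially decaying rate if `λ < λ_c(b)`;
Kelly 1985). A second published proof of the tree statement:
Restrepo–Shin–Tetali–Vigoda–Yang (2013), §4. Weitz's case `b = 1` (`Δ = 2`, all `λ`) is not
included here. The vertex type ranges over `Type` (universe 0, e.g. `Fin n`), which loses nothing:
the statement is invariant under graph isomorphism. A named fact (D-0014): users take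
`(h : Weitz2006_hardCoreSSM)`.
[cite: Weitz2006, Cor. 2.6 with Thm. 2.3-2.4 and Prop. 2.5] -/
def Weitz2006_hardCoreSSM : Prop :=
  ∀ Δ : ℕ, 3 ≤ Δ → ∀ lam : ℝ, 0 < lam → lam < hardCoreThreshold Δ →
    ∃ C α : ℝ, 0 < C ∧ 0 < α ∧
      ∀ (V : Type) [Fintype V] [DecidableEq V] (G : SimpleGraph V) [DecidableRel G.Adj],
        G.maxDegree ≤ Δ → HardCoreExpSSM G lam C α

/-! ### Elementary API -/

variable {G}

/-- `λ_c(4) = 3³/2⁴ = 27/16` (the square-lattice value improved upon by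
Restrepo–Shin–Tetali–Vigoda–Yang). [folklore] -/
theorem hardCoreThreshold_four : hardCoreThreshold 4 = 27 / 16 := by
  norm_num [hardCoreThreshold]

variable (G)

/-- With the empty boundary condition, `hardCoreZ` is the tree's hard-core partition function
`independencePolynomial G λ = ∑_{I independent} λ^{|I|}`. [folklore] -/
theorem hardCoreZ_empty (lam : ℝ) :
    hardCoreZ G lam ∅ ∅ = independencePolynomial G lam := by
  simp [hardCoreZ, independencePolynomial]

/-- `hardCoreZ` is nonnegative for `λ ≥ 0`. [folklore] -/
theorem hardCoreZ_nonneg {lam : ℝ} (hlam : 0 ≤ lam) (Λ R : Finset V) :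
    0 ≤ hardCoreZ G lam Λ R := by
  unfold hardCoreZ
  refine Finset.sum_nonneg fun I _ => ?_
  split_ifs
  · positivity
  · exact le_rfl

/-- A boundary condition `(Λ, R)` with `R ⊆ Λ` independent is feasible: `I = R` contributes
`λ^{|R|} > 0`, so `hardCoreZ G λ Λ R > 0` for `λ > 0` ("we will only consider configurations
`σ_Λ` which specify independent sets of `Λ` so the above conditional probability is well
defined", Weitz §2). [folklore] -/
theorem hardCoreZ_pos {lam : ℝ} (hlam : 0 < lam) {Λ R : Finset V} (hR : R ⊆ Λ)
    (hind : G.IsIndepSet (R : Set V)) : 0 < hardCoreZ G lam Λ R := by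
  unfold hardCoreZ
  have hterm : (0 : ℝ) < (if G.IsIndepSet (R : Set V) ∧ R ∩ Λ = R then lam ^ R.card else 0) := by
    rw [if_pos ⟨hind, Finset.inter_eq_left.mpr hR⟩]
    positivity
  refine lt_of_lt_of_le hterm ?_
  refine Finset.single_le_sum (f := fun I : Finset V =>
    if G.IsIndepSet (I : Set V) ∧ I ∩ Λ = R then lam ^ I.card else 0) (fun I _ => ?_)
    (Finset.mem_univ R)
  split_ifs
  · positivity
  · exact le_rfl

/-- The numerator of `hardCoreOccProb` is termwise dominated by `hardCoreZ`. [folklore] -/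
theorem hardCoreOccProb_num_le {lam : ℝ} (hlam : 0 ≤ lam) (Λ R : Finset V) (v : V) :
    (∑ I : Finset V, if G.IsIndepSet (I : Set V) ∧ I ∩ Λ = R ∧ v ∈ I then lam ^ I.card else 0) ≤
      hardCoreZ G lam Λ R := by
  unfold hardCoreZ
  refine Finset.sum_le_sum fun I _ => ?_
  by_cases h1 : G.IsIndepSet (I : Set V) ∧ I ∩ Λ = R
  · by_cases h2 : v ∈ I
    · rw [if_pos ⟨h1.1, h1.2, h2⟩, if_pos h1]
    · rw [if_neg (fun h => h2 h.2.2), if_pos h1]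
      positivity
  · rw [if_neg (fun h => h1 ⟨h.1, h.2.1⟩), if_neg h1]

/-- Occupation probabilities are nonnegative (`λ ≥ 0`). [folklore] -/
theorem hardCoreOccProb_nonneg {lam : ℝ} (hlam : 0 ≤ lam) (Λ R : Finset V) (v : V) :
    0 ≤ hardCoreOccProb G lam Λ R v := by
  unfold hardCoreOccProb
  refine div_nonneg (Finset.sum_nonneg fun I _ => ?_) (hardCoreZ_nonneg G hlam Λ R)
  split_ifs
  · positivity
  · exact le_rfl

/-- Occupation probabilities are at most `1` (`λ ≥ 0`). [folklore] -/
theorem hardCoreOccProb_le_one {lam : ℝ} (hlam : 0 ≤ lam) (Λ R : Finset V) (v : V) :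
    hardCoreOccProb G lam Λ R v ≤ 1 :=
  div_le_one_of_le₀ (hardCoreOccProb_num_le G hlam Λ R v) (hardCoreZ_nonneg G hlam Λ R)

/-- A vertex prescribed occupied has occupation probability `1` (feasible boundary condition).
[folklore] -/
theorem hardCoreOccProb_eq_one_of_mem {lam : ℝ} {Λ R : Finset V} {v : V} (hv : v ∈ R)
    (hZ : hardCoreZ G lam Λ R ≠ 0) : hardCoreOccProb G lam Λ R v = 1 := by
  unfold hardCoreOccProb
  rw [div_eq_one_iff_eq hZ]
  unfold hardCoreZ
  refine Finset.sum_congr rfl fun I _ => ?_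
  have hiff : (G.IsIndepSet (I : Set V) ∧ I ∩ Λ = R ∧ v ∈ I) ↔
      (G.IsIndepSet (I : Set V) ∧ I ∩ Λ = R) := by
    constructor
    · rintro ⟨h1, h2, -⟩
      exact ⟨h1, h2⟩
    · rintro ⟨h1, h2⟩
      refine ⟨h1, h2, ?_⟩
      have : v ∈ I ∩ Λ := h2 ▸ hv
      exact (Finset.mem_inter.mp this).1
  by_cases h : G.IsIndepSet (I : Set V) ∧ I ∩ Λ = R
  · rw [if_pos (hiff.mpr h), if_pos h]
  · rw [if_neg (fun h' => h (hiff.mp h')), if_neg h]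

/-- A vertex prescribed unoccupied has occupation probability `0`. [folklore] -/
theorem hardCoreOccProb_eq_zero_of_mem_of_not_mem {lam : ℝ} {Λ R : Finset V} {v : V}
    (hvΛ : v ∈ Λ) (hvR : v ∉ R) : hardCoreOccProb G lam Λ R v = 0 := by
  unfold hardCoreOccProb
  rw [div_eq_zero_iff]
  left
  refine Finset.sum_eq_zero fun I _ => ?_
  rw [if_neg]
  rintro ⟨-, h2, h3⟩
  exact hvR (h2 ▸ Finset.mem_inter.mpr ⟨h3, hvΛ⟩)

/-! ### Geometric-rate form of the fact -/

/-- Weitz's theorem in the geometric form `|p_v^{σ} - p_v^{τ}| ≤ C γ^ℓ` with `0 < γ < 1`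
(`γ = e^{-α}`), the shape in which it is quoted by Restrepo–Shin–Tetali–Vigoda–Yang (2013),
Def. 2, and used for `r`-ball approximations of `P_{G,λ}(v ∈ I)`.
[cite: Weitz2006, Cor. 2.6] -/
theorem Weitz2006_hardCoreSSM.geometric (h : Weitz2006_hardCoreSSM) {Δ : ℕ} (hΔ : 3 ≤ Δ)
    {lam : ℝ} (h0 : 0 < lam) (hc : lam < hardCoreThreshold Δ) :
    ∃ C γ : ℝ, 0 < C ∧ 0 < γ ∧ γ < 1 ∧
      ∀ (V : Type) [Fintype V] [DecidableEq V] (G : SimpleGraph V) [DecidableRel G.Adj],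
        G.maxDegree ≤ Δ →
        ∀ (v : V) (Λ R R' : Finset V), R ⊆ Λ → R' ⊆ Λ →
          G.IsIndepSet (R : Set V) → G.IsIndepSet (R' : Set V) →
          ∀ ℓ : ℕ, (∀ w : V, (w ∈ R ↔ w ∉ R') → (ℓ : ℕ∞) ≤ G.edist v w) →
            |hardCoreOccProb G lam Λ R v - hardCoreOccProb G lam Λ R' v| ≤ C * γ ^ ℓ := by
  obtain ⟨C, α, hC, hα, hG⟩ := h Δ hΔ lam h0 hc
  refine ⟨C, Real.exp (-α), hC, Real.exp_pos _, Real.exp_lt_one_iff.mpr (neg_lt_zero.mpr hα), ?_⟩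
  intro V _ _ G _ hdeg v Λ R R' hR hR' hind hind' ℓ hdist
  have key := hG V G hdeg v Λ R R' hR hR' hind hind' ℓ hdist
  have hexp : Real.exp (-(α * ℓ)) = Real.exp (-α) ^ ℓ := by
    rw [← Real.exp_nat_mul]
    congr 1
    ring
  rwa [hexp] at key

end Literature.Probability.LatticeModels

end
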